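import Summits.CriticalPhenomena.CardyFormulaZ2.Theorems.CardySelfDualSegmentSmirnovBasePointBondRealisation
import Literature.Probability.Percolation.DiagonalBoxCrossing
import Literature.Probability.Percolation.CornerPercolation
import Literature.Probability.Percolation.BoxCrossing
import Literature.Probability.Percolation.IsoradialArmExtension
import Literature.Probability.Percolation.Chaining
import Literature.Probability.Percolation.SharpnessDCTProofs
import HarnessLib

/-!
# Stub `stub_diagU_zero_dict` (crux stmt-CriticalPhenomena-5476 `UniformBoxCrossing`, line `Sketch`):
# the `t = 0` dictionary, sites of `𝕋` → bonds of `M_0`, for u-crossings of the turned boxes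

At `t = 0` the corner model `M_0 = cornerPercolation 0` is the push-forward of fair Bernoulli site
percolation on `ℤ²` by `upTriangleConfig` (`cornerPercolation_zero`): both edges `{v, v + e₀}`,
`{v, v + e₁}` of the north-east corner of every open site `v` are open, and nothing else. Two
corners share a lattice vertex iff their sites are adjacent in the triangular lattice `triGraph`
(`ℤ²` plus the antidiagonal `(1, -1)`), so (`stub_bondRealisation`, the bond realisation proved
for the crux `SmirnovBasePoint` of the same route) a `triGraph`-path of open sites inside a set `T`
is realised by an open bond path of `upTriangleConfig ω` through the sites of `T ∩ ω` and the
apexes `x + e₀`, `x + e₁` of such sites.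

In diamond coordinates `col = x₀ - x₁`, `hgt = x₀ + x₁` (`zDia = col + hgt · i`) the apexes of a
site `x` have `col = col x ± 1` and `hgt = hgt x + 1`; hence if `T` is the turned site box
`{A + 1 ≤ col ≤ A + m - 1, B - 2 ≤ hgt ≤ B + 2m + 1}`, the realised bond path lies in the turned
box one unit wider, `{A ≤ col ≤ A + m, B - 2 ≤ hgt ≤ B + 2m + 2}` = the site set
`{re ∈ [0, m], im ∈ [-2, 2m + 2]}` of `embTBCrossing (zDia - (A + B i)) m (2m)`. A site path from
`{hgt ≤ B}` to `{hgt ≥ B + 2m}` therefore gives a member of that top–bottom crossing event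
(`DiagUZeroDict.subset_preimage`; tree tools `PathIn.of_mem_siteConnIn`, `DCT16.mem_openConnIn_of_pathIn`,
`re_zDia_sub_int`, `im_zDia_sub_int`), and the probability inequality `stub_diagU_zero_dict`
follows from `Measure.map_apply` (`measurableSet_embTBCrossing`) and monotonicity.

Sources: Bollobás–Riordan 2010, §2 (the model `M_0` / `H(p)` as site percolation on the triangular
lattice of corners, Thm. 2.2); the path bookkeeping is folklore.
-/

noncomputable section

namespace Summit.CriticalPhenomena.CardyFormulaZ2.Cruxes.UniformBoxCrossing.NonSlantLine

open MeasureTheory Complex Literature.Probability.Percolation Literature.Probability.LatticeModels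
open Literature.Probability.Percolation.TrackExchange

namespace DiagUZeroDict

open Summit.CriticalPhenomena.CardyFormulaZ2.Cruxes.SmirnovBasePoint.ShearedSandwich

/-- The east apex `x + e₀` has column `col x + 1`. [folklore] -/
theorem col_add_vec10 (x : Site 2) : col (x + ![1, 0]) = col x + 1 := by
  simp only [col, Pi.add_apply, Matrix.cons_val_zero, Matrix.cons_val_one]
  ring

/-- The east apex `x + e₀` has height `hgt x + 1`. [folklore] -/
theorem hgtOf_add_vec10 (x : Site 2) : hgtOf (x + ![1, 0]) = hgtOf x + 1 := by
  simp only [hgtOf, Pi.add_apply, Matrix.cons_val_zero, Matrix.cons_val_one]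
  ring

/-- The north apex `x + e₁` has column `col x - 1`. [folklore] -/
theorem col_add_vec01 (x : Site 2) : col (x + ![0, 1]) = col x - 1 := by
  simp only [col, Pi.add_apply, Matrix.cons_val_zero, Matrix.cons_val_one]
  ring

/-- The north apex `x + e₁` has height `hgt x + 1`. [folklore] -/
theorem hgtOf_add_vec01 (x : Site 2) : hgtOf (x + ![0, 1]) = hgtOf x + 1 := by
  simp only [hgtOf, Pi.add_apply, Matrix.cons_val_zero, Matrix.cons_val_one]
  ring

/-- **The realised bond path stays in the wider turned box.** The sites of the turned site box
`T = {A + 1 ≤ col ≤ A + m - 1, B - 2 ≤ hgt ≤ B + 2m + 1}` and the apexes `x + e₀`, `x + e₁` of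
sites `x ∈ T` all lie in `{0 ≤ col - A ≤ m, -2 ≤ hgt - B ≤ 2m + 2}`, the site set of
`embTBCrossing (zDia - (A + B i)) m (2m)`. [folklore] -/
theorem realised_subset (m : ℕ) (A B : ℤ) (ω : SiteConfig (Site 2)) :
    {w : Site 2 | w ∈ {v : Site 2 | A + 1 ≤ col v ∧ col v ≤ A + m - 1 ∧ B - 2 ≤ hgtOf v ∧
          hgtOf v ≤ B + 2 * m + 1} ∩ ω ∨
        ∃ x ∈ {v : Site 2 | A + 1 ≤ col v ∧ col v ≤ A + m - 1 ∧ B - 2 ≤ hgtOf v ∧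
          hgtOf v ≤ B + 2 * m + 1} ∩ ω, w = x + ![1, 0] ∨ w = x + ![0, 1]} ⊆
      {v : Site 2 | (zDia v - ((A : ℂ) + (B : ℂ) * I)).re ∈ Set.Icc (0 : ℝ) m ∧
        (zDia v - ((A : ℂ) + (B : ℂ) * I)).im ∈ Set.Icc (-2 : ℝ) (2 * m + 2)} := by
  intro w hw
  simp only [Set.mem_setOf_eq, re_zDia_sub_int, im_zDia_sub_int, Set.mem_Icc]
  -- reduce to integer inequalities on `col w`, `hgtOf w`
  suffices h : A ≤ col w ∧ col w ≤ A + m ∧ B - 2 ≤ hgtOf w ∧ hgtOf w ≤ B + 2 * m + 2 by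
    obtain ⟨h1, h2, h3, h4⟩ := h
    have i1 : ((A : ℤ) : ℝ) ≤ col w := by exact_mod_cast h1
    have i2 : (col w : ℝ) ≤ A + m := by exact_mod_cast h2
    have i3 : ((B : ℤ) : ℝ) - 2 ≤ hgtOf w := by exact_mod_cast h3
    have i4 : (hgtOf w : ℝ) ≤ B + 2 * m + 2 := by exact_mod_cast h4
    exact ⟨⟨by linarith, by linarith⟩, by linarith, by linarith⟩
  rcases hw with ⟨⟨h1, h2, h3, h4⟩, -⟩ | ⟨x, ⟨⟨h1, h2, h3, h4⟩, -⟩, rfl | rfl⟩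
  · exact ⟨by omega, by omega, by omega, by omega⟩
  · rw [col_add_vec10, hgtOf_add_vec10]
    exact ⟨by omega, by omega, by omega, by omega⟩
  · rw [col_add_vec01, hgtOf_add_vec01]
    exact ⟨by omega, by omega, by omega, by omega⟩

/-- **The dictionary, deterministic part.** If `ω` has an open-site `triGraph` path inside the
turned site box `{A + 1 ≤ col ≤ A + m - 1, B - 2 ≤ hgt ≤ B + 2m + 1}` from a site of height `≤ B`
to a site of height `≥ B + 2m`, then `upTriangleConfig ω` has an open-bond top–bottom crossing
`embTBCrossing (zDia - (A + B i)) m (2m)`: realise the site path by bonds (`stub_bondRealisation`),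
keep the endpoints, and use `realised_subset`. [cite: BollobasRiordan2010, §2 Thm. 2.2 (site percolation on a triangulation, p = 1/2)] -/
theorem subset_preimage (m : ℕ) (A B : ℤ) :
    {ω : SiteConfig (Site 2) | ∃ x y : Site 2, hgtOf x ≤ B ∧ B + 2 * m ≤ hgtOf y ∧
        ω ∈ siteConnIn triGraph
          {v | A + 1 ≤ col v ∧ col v ≤ A + m - 1 ∧ B - 2 ≤ hgtOf v ∧ hgtOf v ≤ B + 2 * m + 1} x y} ⊆
      upTriangleConfig ⁻¹' embTBCrossing (fun v => zDia v - ((A : ℂ) + (B : ℂ) * I)) m (2 * m) := by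
  rintro ω ⟨x, y, hx, hy, hω⟩
  have hpath := stub_bondRealisation ω _ x y (PathIn.of_mem_siteConnIn hω)
  refine ⟨x, ?_, y, ?_, DCT16.mem_openConnIn_of_pathIn (hpath.mono (realised_subset m A B ω))⟩
  · show (zDia x - ((A : ℂ) + (B : ℂ) * I)).im ≤ 0
    rw [im_zDia_sub_int]
    have i1 : (hgtOf x : ℝ) ≤ B := by exact_mod_cast hx
    linarith
  · show (2 * m : ℝ) ≤ (zDia y - ((A : ℂ) + (B : ℂ) * I)).im
    rw [im_zDia_sub_int]
    have i1 : (B : ℝ) + 2 * m ≤ hgtOf y := by exact_mod_cast hy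
    linarith

end DiagUZeroDict

/-- **Stub 4: the `t = 0` dictionary (sites of `𝕋` → bonds of `M_0`).** `cornerPercolation 0` is
the push-forward of `triSitePercolation half` by `upTriangleConfig` (`cornerPercolation_zero`); an
open-site `triGraph` path inside `{A+1 ≤ col ≤ A+m-1, B-2 ≤ hgt ≤ B+2m+1}` from `{hgt ≤ B}` to
`{hgt ≥ B+2m}` opens both edges of every corner on it, and consecutive corners share a lattice
vertex, so it yields an open-bond u-crossing of the turned `m × 2m` box one unit wider
(`embTBCrossing (zDia - (A + B i)) m (2m)`: inside `{0 ≤ col - A ≤ m, -2 ≤ hgt - B ≤ 2m+2}` from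
`{hgt ≤ B}` to `{hgt ≥ B + 2m}`). Hence the probability inequality. (The hypothesis `1 ≤ m` is
part of the registered signature; the inclusion holds for every `m`.)
[cite: BollobasRiordan2010, §2 Thm. 2.2 (site percolation on a triangulation, p = 1/2)] -/
theorem stub_diagU_zero_dict (m : ℕ) (A B : ℤ) (hm : 1 ≤ m) :
    (triSitePercolation half).real {ω | ∃ x y : Site 2, hgtOf x ≤ B ∧ B + 2 * m ≤ hgtOf y ∧
        ω ∈ siteConnIn triGraph
          {v | A + 1 ≤ col v ∧ col v ≤ A + m - 1 ∧ B - 2 ≤ hgtOf v ∧ hgtOf v ≤ B + 2 * m + 1} x y} ≤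
      (cornerPercolation 0).real (embTBCrossing (fun v => zDia v - ((A : ℂ) + (B : ℂ) * I)) m (2 * m)) := by
  have _ := hm
  rw [cornerPercolation_zero, map_measureReal_apply measurable_upTriangleConfig
    (IsoradialArmExtension.measurableSet_embTBCrossing _ _ _)]
  exact measureReal_mono (DiagUZeroDict.subset_preimage m A B) (measure_ne_top _ _)

end Summit.CriticalPhenomena.CardyFormulaZ2.Cruxes.UniformBoxCrossing.NonSlantLine
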